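import Literature.Geometry.Symplectic.PlanarHomologySphereFillingsProofs
import Literature.Geometry.Symplectic.PlanarSteinDictionary
import Literature.Geometry.Symplectic.KahlerDecompositionIsotopy
import Literature.Topology.FourManifolds.PlanarLefschetzBodyFacts
import Literature.AlgebraicTopology.SingularHomology.ExcisionMayerVietoris
import HarnessLib

/-!
# Oba 2016, Thm. 1.1 routed through the planar Stein dictionary: doubles of Stein domains are
# Stein bisections, Wendl's theorem for ONE Stein filling, the word-level readings `|A| = n`,
# unimodularity and the parity of the blocks, and the fact modulo the named dictionary facts

Second sibling (proofs) file of `PlanarHomologySphereFillings.lean` — the named fact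
`Literature.Geometry.Symplectic.Oba2016_steinFilling_fourHoledSphere` (T. Oba, *Stein fillings of
homology `3`-spheres and mapping class groups*, Geom. Dedicata 183 (2016), Thm. 1.1) — next to
`PlanarHomologySphereFillingsProofs.lean`.  Everything here is **proved**; no definitions, no named
facts, and the statement of the fact is untouched.

Oba's proof of Thm. 1.1 (§3.2) starts: *"By Theorem 1.3* [Wendl 2010, Thm. 1] *and Proposition 3.6,
`X` admits a PALF `f : X → D²` with fiber `Σ_{0,4}` … `φ = t_γ ∘ t_β ∘ t_α` … Suppose that `α, β` and
`γ` are all non-boundary curves … `H₁(X; ℤ)` has a torsion … Therefore at least one of the curves is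
a boundary curve"*, and ends with the cancellation of two `1`/`2`-handle pairs in the three cases
(1)–(3) (Fig. 2).  Since the first sibling file was written, the vocabulary programme of the crux
`ConvexBisection.PlanarAcyclicBisectionRigidity` has FILED the inputs of this argument as named
facts over the planar word calculus (`PlanarAchiralWords.lean`) and the planar Lefschetz bodies
`X(P_n; w)` (`IsPlanarLefschetzBody`, `PlanarLefschetzBody.lean`):

* F-W `wendl_planarSteinBisection` (`PlanarSteinDictionary.lean`) — Wendl 2010, Thm. 1, stated for
  BOTH halves of a Stein bisection `M = e₁(W₁) ∪ e₂(W₂)` along a common planar contact seam;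
* the readers `planarLefschetzBody_length_of_acyclic` (`χ`: a ℚ-acyclic `X(P_n; w)` has `n`
  letters — Kas 1980 / Gompf–Stipsicz §8.1–8.2, Oba's Prop. 3.5–3.6) and
  `planarLefschetzBody_unimodular_of_isZero_H1` (`H₁(X(P_n; w); ℤ) = ℤⁿ/⟨[cᵢ]⟩`, Gompf–Stipsicz
  §8.2 p. 292) (`PlanarLefschetzBodyFacts.lean`);
* F-a `supportedPlanarMonodromy` (`PlanarMonodromy.lean`), already consumed by the first sibling
  file (`Oba2016_steinFilling_fourHoledSphere_of_supported_of_endgame`).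

**STATUS (added 2026-08-17, after `Literature/Topology/FourManifolds/PlanarLefschetzBodyCounterexample.lean`).**
The two readers are FALSE as filed: the page-system clause `IsPageSystem` of
`IsLefschetzHandlebodyOver` does not tie the page system to the binding tubes, so `𝔻⁴` with the
positive Hopf open book on `S³` is "`X(P₁; ∅)`" (`isPlanarLefschetzBody_closedBall_one_nil`), whence
`not_planarLefschetzBody_length_of_acyclic` and `not_planarLefschetzBody_unimodular_of_isZero_H1`.
Consequently every theorem below taking `(h1 : planarLefschetzBody_length_of_acyclic)` or
`(h2 : planarLefschetzBody_unimodular_of_isZero_H1)` — `Oba2016_length_eq_of_contractible`,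
`Oba2016_unimodular_of_contractible`, `Oba2016_planarLefschetzBody_of_supported`,
`Oba2016_steinFilling_fourHoledSphere_of_dictionary` — is VACUOUSLY true and closes nothing until
the vocabulary is repaired and the readers restated; the theorems not taking them
(`steinBisection_of_isBoundaryGluing`, `steinBisection_of_isDouble`,
`wendl_planarSteinFilling_of_bisection`, the parity §) are unaffected, and the route to the fact that
avoids the readers is `Oba2016_steinFilling_fourHoledSphere_of_supported_of_endgame`
(`PlanarHomologySphereFillingsProofs.lean`).

This file threads Oba's argument through them, proving the connecting steps:

* `steinBisection_of_isBoundaryGluing`, `steinBisection_of_isDouble` — **a gluing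
  `X = W₁ ∪_ψ W₂` of two compact Stein domains whose gluing map carries the complex tangencies of
  `∂W₁` onto those of `∂W₂` (the conclusion shape of `baykur_kahlerDecomposition`) IS a Stein
  bisection along a common contact seam** in the shape of the hypotheses of
  `wendl_planarSteinBisection` (and of route `ConvexBisection`): the two embeddings cover `X`, meet
  exactly in the images of both boundaries, and push the complex tangencies forward to the same
  plane at every common point (chain rule along `e₁ ∘ b₁.incl = e₂ ∘ b₂.incl ∘ ψ`, with
  `d(b.incl)(b.incl^* ξ) = ξ`, `map_mfderiv_boundaryDataIncl_boundaryPlaneField`).  In particular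
  the DOUBLE `D(W) = W ∪_{id} W̄` of a compact Stein domain (Baykur 2006, §6 Example 2; it exists by
  `exists_isDouble_and_baykur_conclusion`) is a Stein bisection with both halves `(W, J)`.
* `wendl_planarSteinFilling_of_bisection` — **Wendl's theorem for ONE Stein filling, from F-W**:
  if `wendl_planarSteinBisection` holds then every compact Stein domain `(W, J)` whose boundary
  complex tangencies carry a Giroux form, positively framed, with planar monodromy `(P_n, φ)`, is
  the planar Lefschetz body `X(P_n; A)` of a positive factorisation `A` of `φ` into in-range
  syntactic curves (apply F-W to the double).  This is Oba's Thm. 1.3 ⟹ *"`X` admits a PALF"*.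
* `Oba2016_length_eq_of_contractible`, `Oba2016_unimodular_of_contractible` — for a CONTRACTIBLE
  planar Lefschetz body the two readers apply (`H_k(W; ℚ) = 0`, `k > 0`, and `H₁(W; ℤ) = 0` by
  `isZero_singularHomology_of_contractibleSpace`): `|A| = n` (Prop. 3.6) and the hole-set matrix of
  `A` is unimodular (Lemma 3.4 read in `H₁(P_n) = ℤⁿ`).
* `Oba2016_planarLefschetzBody_of_supported` — **modulo F-a and F-W, the Stein filling of the fact
  is a planar PALF body `X(P_n; A)` on `n + 1 ≤ ob.k` binding components with `|A| = n` unimodular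
  in-range curves** (the first paragraph of §3.2 in the tree's words).
* `Oba2016_parity_aut`, `Oba2016_parity_blockWord`, `Oba2016_parity_cls`,
  `Oba2016_exists_odd_block_of_unimodular` — **Oba's parity step, proved over the calculus**: a
  mod-2 exponent sum `F_n → ℤ/2` is invariant under every arc-data automorphism (conjugations die
  in an abelian group), so it reads the class of the syntactic curve `g(c_[a,b])` as the parity of
  the number `b + 1 - a` of enclosed holes; if every curve of `A` enclosed an EVEN number of holes,
  all classes would lie in the index-`2` kernel and could not generate `F_nᵃᵇ = ℤⁿ` (`n ≥ 1`).  Hence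
  a unimodular `A` has a curve enclosing an ODD number of holes — for `n = 3` (page `Σ_{0,4}`) a
  curve enclosing one hole or all three, i.e. a BOUNDARY curve
  (`Oba2016_exists_boundaryParallel_of_unimodular_three`): *"at least one of the curves `α, β` and
  `γ` is a boundary curve"*.
* `Oba2016_steinFilling_fourHoledSphere_of_dictionary` — **the fact from the named dictionary
  facts F-a, F-W, the two readers, and the residual geometric endgame `hX` in word currency**: every
  planar Lefschetz body `X(P_n; A)` with `n ≤ 3`, `|A| = n` in-range curves and unimodular hole-set
  matrix carries a Morse function adapted to the boundary with at most one critical point of index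
  `1` and all indices `≤ 2` — Kas' decomposition `h⁰ ∪ n h¹ ∪ n h²` with its incidences and the
  cancellation of two `1`/`2` pairs (§3.2, cases (1)–(3), Fig. 2), the part of the printed proof
  for which the tree has the cancellation theorems (`Cobordism.Milnor1965_firstCancellation_slab_holds`)
  but not yet the incidence geometry of `IsLefschetzHandlebodyOver`.

## References

* T. Oba, *Stein fillings of homology `3`-spheres and mapping class groups*, Geom. Dedicata 183
  (2016), 69–80 (arXiv:1407.5257), Thm. 1.3, Prop. 3.6, Lemma 3.4 and the proof of Thm. 1.1, §3.2
  (arXiv pp. 3, 7–8). [Oba2016]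
* C. Wendl, *Strongly fillable contact manifolds and `J`-holomorphic foliations*, Duke Math. J.
  151 (2010), 337–384 (arXiv:0806.3193), Thm. 1. [Wendl2010]
* R. İ. Baykur, *Kähler decomposition of 4-manifolds*, Algebr. Geom. Topol. 6 (2006), 1239–1265,
  §6 Example 2 (doubles). [Baykur2006]
* R. E. Gompf, A. I. Stipsicz, *4-Manifolds and Kirby Calculus*, GSM 20 (1999), §8.1–§8.2.
  [GompfStipsiczGSM1999]
* M. W. Hirsch, *Differential Topology*, GTM 33 (1976), Ch. 8 §2 (gluing, doubles). [HirschDT1976]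
-/

noncomputable section

open scoped Manifold ContDiff Topology
open Set Function

namespace Literature.Geometry.Symplectic

open Literature.Topology.FourManifolds
open Literature.Topology.FourManifolds.PlanarWords
open Literature.AlgebraicTopology.SingularHomology (isZero_singularHomology_of_contractibleSpace)

universe u

/-! ### A gluing of two Stein domains with matched complex tangencies is a Stein bisection -/

section Bisection

variable {W₁ : Type u} [TopologicalSpace W₁] [ChartedSpace (EuclideanHalfSpace 4) W₁]
  [IsManifold (𝓡∂ 4) ∞ W₁]
  {W₂ : Type u} [TopologicalSpace W₂] [ChartedSpace (EuclideanHalfSpace 4) W₂]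
  {X : Type*} [TopologicalSpace X] [ChartedSpace (EuclideanSpace ℝ (Fin 4)) X]

/-- **A gluing of two Stein domains with matched complex tangencies is a Stein bisection along a
common contact seam.**  Let `X = W₁ ∪_ψ W₂` (`IsBoundaryGluing b₁ b₂ ψ (𝓡 4) X`) be a gluing of two
4-manifolds with boundary along a diffeomorphism `ψ : ∂W₁ ≅ ∂W₂` of abstract boundaries, and let
`J₁`, `J₂` be fields of endomorphisms of `TW₁`, `TW₂` such that `d(b₂.incl ∘ ψ)` carries the
boundary plane field `ξ₁ = b₁.incl^* ξ_{J₁}` onto the complex tangencies `ξ_{J₂}` of `∂W₂` (the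
matching clause of `baykur_kahlerDecomposition`, Baykur 2006, Thm. 5.1).  Then the two embeddings
`e₁ : W₁ → X`, `e₂ : W₂ → X` of the gluing cover `X`, meet exactly in the images of BOTH boundaries
(`range e₁ ∩ range e₂ = e₁(∂W₁) = e₂(∂W₂)`), intertwine the gluing map (`e₁ ∘ b₁.incl = e₂ ∘ b₂.incl ∘ ψ`),
and push the complex tangencies forward to the same plane at every common point — the hypothesis
shape of `wendl_planarSteinBisection` and of route `ConvexBisection`.  Proof: the seam equations are
the gluing relation read through `range bᵢ.incl = ∂Wᵢ`; at a common point `e₁ w₁ = e₂ w₂` one has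
`w₁ = b₁.incl z`, `w₂ = b₂.incl (ψ z)`, and by `ξ_{J₁} = d(b₁.incl)(ξ₁)`
(`map_mfderiv_boundaryDataIncl_boundaryPlaneField`) and the hypothesis both pushed-forward planes
are `d(e₁ ∘ b₁.incl)_z (ξ₁)_z = d(e₂ ∘ b₂.incl ∘ ψ)_z (ξ₁)_z` (chain rule).  Hirsch 1976, Ch. 8 §2
(the pieces of `M ∪_f N`). [cite: HirschDT1976, Ch. 8 §2] [cite: Baykur2006, Thm. 5.1] -/
theorem steinBisection_of_isBoundaryGluing
    (J₁ : (x : W₁) → ((EuclideanSpace ℝ (Fin 4)) →L[ℝ] (EuclideanSpace ℝ (Fin 4))))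
    (J₂ : (x : W₂) → ((EuclideanSpace ℝ (Fin 4)) →L[ℝ] (EuclideanSpace ℝ (Fin 4))))
    (b₁ : BoundaryData (𝓡∂ 4) W₁ (𝓡 3)) (b₂ : BoundaryData (𝓡∂ 4) W₂ (𝓡 3))
    (ψ : b₁.carrier ≃ₘ⟮𝓡 3, 𝓡 3⟯ b₂.carrier)
    (hξ : ∀ z, Submodule.map (mfderiv (𝓡 3) (𝓡∂ 4) (b₂.incl ∘ ψ) z).toLinearMap
      (boundaryPlaneField J₁ b₁ z) = contactPlane J₂ (b₂.incl (ψ z)))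
    (hglue : IsBoundaryGluing b₁ b₂ ψ (𝓡 4) X) :
    ∃ (e₁ : W₁ → X) (e₂ : W₂ → X),
      Manifold.IsSmoothEmbedding (𝓡∂ 4) (𝓡 4) ∞ e₁ ∧ Manifold.IsSmoothEmbedding (𝓡∂ 4) (𝓡 4) ∞ e₂ ∧
      range e₁ ∪ range e₂ = univ ∧ range e₁ ∩ range e₂ = e₁ '' (𝓡∂ 4).boundary W₁ ∧
      range e₁ ∩ range e₂ = e₂ '' (𝓡∂ 4).boundary W₂ ∧
      (∀ z, e₁ (b₁.incl z) = e₂ (b₂.incl (ψ z))) ∧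
      ∀ w₁ w₂, e₁ w₁ = e₂ w₂ →
        Submodule.map (mfderiv (𝓡∂ 4) (𝓡 4) e₁ w₁).toLinearMap (contactPlane J₁ w₁) =
        Submodule.map (mfderiv (𝓡∂ 4) (𝓡 4) e₂ w₂).toLinearMap (contactPlane J₂ w₂) := by
  obtain ⟨jA, jB, hA, hB, hU, hR⟩ := hglue
  have hrel : ∀ z, jA (b₁.incl z) = jB (b₂.incl (ψ z)) := fun z => (hR _ _).2 ⟨z, rfl, rfl⟩
  refine ⟨jA, jB, hA, hB, hU, ?_, ?_, hrel, ?_⟩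
  · ext x
    constructor
    · rintro ⟨⟨a, rfl⟩, ⟨c, hc⟩⟩
      obtain ⟨z, rfl, -⟩ := (hR a c).1 hc.symm
      exact ⟨b₁.incl z, b₁.incl_mem_boundary z, rfl⟩
    · rintro ⟨a, ha, rfl⟩
      rw [← b₁.range_incl] at ha
      obtain ⟨z, rfl⟩ := ha
      exact ⟨mem_range_self _, ⟨b₂.incl (ψ z), (hrel z).symm⟩⟩
  · ext x
    constructor
    · rintro ⟨⟨a, rfl⟩, ⟨c, hc⟩⟩
      obtain ⟨z, rfl, rfl⟩ := (hR a c).1 hc.symm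
      exact ⟨b₂.incl (ψ z), b₂.incl_mem_boundary _, (hrel z).symm⟩
    · rintro ⟨c, hc, rfl⟩
      rw [← b₂.range_incl] at hc
      obtain ⟨y, rfl⟩ := hc
      refine ⟨⟨b₁.incl (ψ.symm y), ?_⟩, mem_range_self _⟩
      rw [hrel, Diffeomorph.apply_symm_apply]
  · intro w₁ w₂ hw
    obtain ⟨z, rfl, rfl⟩ := (hR w₁ w₂).1 hw
    have hιA : MDifferentiableAt (𝓡 3) (𝓡∂ 4) b₁.incl z :=
      b₁.isSmoothEmbedding.contMDiff.mdifferentiableAt (by simp)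
    have hιB : MDifferentiableAt (𝓡 3) (𝓡∂ 4) (b₂.incl ∘ ψ) z :=
      (b₂.isSmoothEmbedding.contMDiff.comp ψ.contMDiff).mdifferentiableAt (by simp)
    have hjA : MDifferentiableAt (𝓡∂ 4) (𝓡 4) jA (b₁.incl z) :=
      hA.contMDiff.mdifferentiableAt (by simp)
    have hjB : MDifferentiableAt (𝓡∂ 4) (𝓡 4) jB ((b₂.incl ∘ ψ) z) :=
      hB.contMDiff.mdifferentiableAt (by simp)
    have eA := mfderiv_comp z hjA hιA
    have eB := mfderiv_comp z hjB hιB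
    have hfun : jA ∘ b₁.incl = jB ∘ (b₂.incl ∘ ψ) := funext hrel
    have hcA : Submodule.map (mfderiv (𝓡 3) (𝓡 4) (jA ∘ b₁.incl) z).toLinearMap
        (boundaryPlaneField J₁ b₁ z) =
        Submodule.map (mfderiv (𝓡∂ 4) (𝓡 4) jA (b₁.incl z)).toLinearMap
          (Submodule.map (mfderiv (𝓡 3) (𝓡∂ 4) b₁.incl z).toLinearMap
            (boundaryPlaneField J₁ b₁ z)) := by
      rw [← Submodule.map_comp]
      exact congrArg (fun T : TangentSpace (𝓡 3) z →L[ℝ] TangentSpace (𝓡 4) (jA (b₁.incl z)) =>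
        Submodule.map T.toLinearMap (boundaryPlaneField J₁ b₁ z)) eA
    have hcB : Submodule.map (mfderiv (𝓡 3) (𝓡 4) (jB ∘ (b₂.incl ∘ ψ)) z).toLinearMap
        (boundaryPlaneField J₁ b₁ z) =
        Submodule.map (mfderiv (𝓡∂ 4) (𝓡 4) jB ((b₂.incl ∘ ψ) z)).toLinearMap
          (Submodule.map (mfderiv (𝓡 3) (𝓡∂ 4) (b₂.incl ∘ ψ) z).toLinearMap
            (boundaryPlaneField J₁ b₁ z)) := by
      rw [← Submodule.map_comp]
      exact congrArg (fun T : TangentSpace (𝓡 3) z →L[ℝ] TangentSpace (𝓡 4) (jB ((b₂.incl ∘ ψ) z)) =>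
        Submodule.map T.toLinearMap (boundaryPlaneField J₁ b₁ z)) eB
    -- the three links of the chain (as `Eq.trans`, the base points being only propositionally equal)
    have eq1 : Submodule.map (mfderiv (𝓡∂ 4) (𝓡 4) jA (b₁.incl z)).toLinearMap
        (contactPlane J₁ (b₁.incl z)) =
        Submodule.map (mfderiv (𝓡 3) (𝓡 4) (jA ∘ b₁.incl) z).toLinearMap
          (boundaryPlaneField J₁ b₁ z) := by
      rw [← map_mfderiv_boundaryDataIncl_boundaryPlaneField J₁ b₁ z]
      exact hcA.symm
    have eq2 : Submodule.map (mfderiv (𝓡∂ 4) (𝓡 4) jB (b₂.incl (ψ z))).toLinearMap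
        (contactPlane J₂ (b₂.incl (ψ z))) =
        Submodule.map (mfderiv (𝓡 3) (𝓡 4) (jB ∘ (b₂.incl ∘ ψ)) z).toLinearMap
          (boundaryPlaneField J₁ b₁ z) := by
      rw [← hξ z]
      exact hcB.symm
    have eq3 : (Submodule.map (mfderiv (𝓡 3) (𝓡 4) (jA ∘ b₁.incl) z).toLinearMap
        (boundaryPlaneField J₁ b₁ z) : Submodule ℝ (EuclideanSpace ℝ (Fin 4))) =
        Submodule.map (mfderiv (𝓡 3) (𝓡 4) (jB ∘ (b₂.incl ∘ ψ)) z).toLinearMap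
          (boundaryPlaneField J₁ b₁ z) :=
      congrArg (fun F : b₁.carrier → X =>
        (Submodule.map (mfderiv (𝓡 3) (𝓡 4) F z).toLinearMap (boundaryPlaneField J₁ b₁ z) :
          Submodule ℝ (EuclideanSpace ℝ (Fin 4)))) hfun
    exact eq1.trans (eq3.trans eq2.symm)

/-- **The double of a Stein domain is a Stein bisection with both halves `(W, J)`** (Baykur 2006, §6
Example 2: *"The easiest examples are doubles"*): if `X = D(W) = W ∪_{id} W` (`IsDouble b (𝓡 4) X`)
then the two embeddings of `W` cover `X`, meet exactly in the images of the boundary, agree on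
`b.incl`, and push the complex tangencies `ξ_J` of `∂W` forward to the same plane at every common
point — `steinBisection_of_isBoundaryGluing` for `ψ = id`, whose matching clause is
`map_mfderiv_boundaryDataIncl_boundaryPlaneField`. [cite: Baykur2006, §6 Example 2]
[cite: HirschDT1976, Ch. 8 §2] -/
theorem steinBisection_of_isDouble
    (J : (x : W₁) → ((EuclideanSpace ℝ (Fin 4)) →L[ℝ] (EuclideanSpace ℝ (Fin 4))))
    (b : BoundaryData (𝓡∂ 4) W₁ (𝓡 3)) (hD : IsDouble b (𝓡 4) X) :
    ∃ (e₁ : W₁ → X) (e₂ : W₁ → X),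
      Manifold.IsSmoothEmbedding (𝓡∂ 4) (𝓡 4) ∞ e₁ ∧ Manifold.IsSmoothEmbedding (𝓡∂ 4) (𝓡 4) ∞ e₂ ∧
      range e₁ ∪ range e₂ = univ ∧ range e₁ ∩ range e₂ = e₁ '' (𝓡∂ 4).boundary W₁ ∧
      range e₁ ∩ range e₂ = e₂ '' (𝓡∂ 4).boundary W₁ ∧
      (∀ z, e₁ (b.incl z) = e₂ (b.incl z)) ∧
      ∀ w₁ w₂, e₁ w₁ = e₂ w₂ →
        Submodule.map (mfderiv (𝓡∂ 4) (𝓡 4) e₁ w₁).toLinearMap (contactPlane J w₁) =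
        Submodule.map (mfderiv (𝓡∂ 4) (𝓡 4) e₂ w₂).toLinearMap (contactPlane J w₂) := by
  have hglue : IsBoundaryGluing b b (Diffeomorph.refl (𝓡 3) b.carrier ∞) (𝓡 4) X := by
    rw [Diffeomorph.coe_refl]
    exact hD
  have hξ : ∀ z, Submodule.map
      (mfderiv (𝓡 3) (𝓡∂ 4) (b.incl ∘ (Diffeomorph.refl (𝓡 3) b.carrier ∞)) z).toLinearMap
      (boundaryPlaneField J b z) = contactPlane J (b.incl (Diffeomorph.refl (𝓡 3) b.carrier ∞ z)) := by
    intro z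
    rw [Diffeomorph.coe_refl, Function.comp_id]
    exact map_mfderiv_boundaryDataIncl_boundaryPlaneField J b z
  obtain ⟨e₁, e₂, h₁, h₂, hU, hs₁, hs₂, hrel, hC⟩ :=
    steinBisection_of_isBoundaryGluing J J b b _ hξ hglue
  refine ⟨e₁, e₂, h₁, h₂, hU, hs₁, hs₂, fun z => ?_, hC⟩
  simpa using hrel z

end Bisection

/-! ### Wendl's theorem for one Stein filling, from the bisection form F-W -/

/-- **Wendl 2010, Thm. 1 for ONE Stein filling, from `wendl_planarSteinBisection`.**  Suppose F-W
(`hW`).  Let `(W, J)` be a compact Stein domain, `b` a boundary datum, and `K` an open book of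
`b.carrier ≅ ∂W` in Giroux form `α` for the complex tangencies `ξ_J = boundaryPlaneField J b`,
positively framed, with planar monodromy `K.HasPlanarMonodromy n φ`.  Then `W` is the planar
Lefschetz body `X(P_n; A)` of a POSITIVE factorisation `A` of `φ` into in-range syntactic curves:
`∀ c ∈ A, c.InRange n`, `monodromy n (positiveWord A) = φ`, `IsPlanarLefschetzBody W n (positiveWord A)`
— Wendl: *"`(W, ω)` is symplectically deformation equivalent to a blow-up of a symplectic Lefschetz
fibration whose boundary open book is `π`"*, no blow-up for a Stein filling (Oba 2016, Thm. 1.3 and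
the sentence after it: *"`X` is diffeomorphic to the total space of the PALF"*).  Proof: the double
`D(W)` exists (`exists_isDouble_and_baykur_conclusion`) and is a Stein bisection with both halves
`(W, J)` (`steinBisection_of_isDouble`); apply F-W to it and keep the first half.
[cite: Wendl2010, Thm. 1] [cite: Oba2016, Thm. 1.3] -/
theorem wendl_planarSteinFilling_of_bisection (hW : wendl_planarSteinBisection)
    {W : Type} [TopologicalSpace W] [T2Space W] [SecondCountableTopology W]
    [ChartedSpace (EuclideanHalfSpace 4) W] [IsManifold (𝓡∂ 4) ∞ W] [CompactSpace W]
    (S : SteinStructure W) (b : BoundaryData (𝓡∂ 4) W (𝓡 3)) (K : OpenBook b.carrier)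
    (α : Kaehler.MForm (𝓡 3) b.carrier ℝ 1) (n : ℕ) (φ : ArcData n)
    (hG : K.IsGirouxForm (boundaryPlaneField S.J b) α) (hpos : IsPositivelyFramed K α)
    (hmono : K.HasPlanarMonodromy n φ) :
    ∃ A : List PlanarCurve, (∀ c ∈ A, c.InRange n) ∧ monodromy n (positiveWord A) = φ ∧
      IsPlanarLefschetzBody W n (positiveWord A) := by
  obtain ⟨X, _, _, _, _, _, _, hD, -⟩ := exists_isDouble_and_baykur_conclusion S b
  obtain ⟨e₁, e₂, h₁, h₂, hU, hs₁, hs₂, -, hC⟩ := steinBisection_of_isDouble S.J b hD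
  obtain ⟨A, B, hAB, hA, -, hXA, -, -⟩ :=
    hW X W W S S e₁ e₂ h₁ h₂ hU hs₁ hs₂ hC b K α n φ hG hpos hmono
  exact ⟨A, fun c hc => hAB c (List.mem_append_left _ hc), hA, hXA⟩

/-! ### The readers for a contractible planar Lefschetz body: `|A| = n` and unimodularity -/

/-- (VACUOUS as filed: the hypothesis `h1` is refuted by
`Literature.Topology.FourManifolds.not_planarLefschetzBody_length_of_acyclic`; see the module
docstring, STATUS.)  **A contractible planar Lefschetz body over `P_n` has exactly `n` letters** (Oba 2016,
Prop. 3.6: *"`X` admits a PALF … with fiber `Σ_{0,n+1}` … the number of singular fibers is equal to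
`n`"*; here from the reader `planarLefschetzBody_length_of_acyclic` — `χ(X(P_n; w)) = 1 − n + |w|`,
Gompf–Stipsicz §8.1 — and `H_k(X; ℚ) = 0` for `k > 0`, `isZero_singularHomology_of_contractibleSpace`).
[cite: Oba2016, Prop. 3.6] [cite: GompfStipsiczGSM1999, §8.1] -/
theorem Oba2016_length_eq_of_contractible (h1 : planarLefschetzBody_length_of_acyclic)
    {X : Type} [TopologicalSpace X] [T2Space X] [SecondCountableTopology X]
    [ChartedSpace (EuclideanHalfSpace 4) X] [IsManifold (𝓡∂ 4) ∞ X] [CompactSpace X]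
    [ContractibleSpace X] {n : ℕ} {w : List Letter} (hX : IsPlanarLefschetzBody X n w) :
    w.length = n :=
  h1 X n w hX fun _ hk => isZero_singularHomology_of_contractibleSpace ℚ ℚ hk.ne'

/-- (VACUOUS as filed: the hypothesis `h2` is refuted by
`Literature.Topology.FourManifolds.not_planarLefschetzBody_unimodular_of_isZero_H1`; see the module
docstring, STATUS.)  **The hole-set matrix of a contractible planar Lefschetz body is unimodular** (Oba 2016,
Lemma 3.4, `H₁(X; ℤ) = 0`, read through `H₁(X(P_n; A); ℤ) = ℤⁿ/⟨[cᵢ]⟩` — Gompf–Stipsicz §8.2,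
p. 292, the reader `planarLefschetzBody_unimodular_of_isZero_H1` — for the contractible `X`,
`isZero_singularHomology_of_contractibleSpace`): the classes of the curves of `A` generate `F_nᵃᵇ`.
[cite: Oba2016, Lemma 3.4] [cite: GompfStipsiczGSM1999, §8.2 p. 292] -/
theorem Oba2016_unimodular_of_contractible (h2 : planarLefschetzBody_unimodular_of_isZero_H1)
    {X : Type} [TopologicalSpace X] [T2Space X] [SecondCountableTopology X]
    [ChartedSpace (EuclideanHalfSpace 4) X] [IsManifold (𝓡∂ 4) ∞ X] [CompactSpace X]
    [ContractibleSpace X] {n : ℕ} {A : List PlanarCurve}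
    (hX : IsPlanarLefschetzBody X n (positiveWord A)) : Unimodular n A := by
  have h := h2 X n (positiveWord A) hX (isZero_singularHomology_of_contractibleSpace ℤ ℤ one_ne_zero)
  have hmap : (positiveWord A).map Prod.fst = A := by
    simp [positiveWord, List.map_map, Function.comp_def]
  rwa [hmap] at h

/-- (VACUOUS as filed: the hypotheses `h1`, `h2` are refuted in
`Literature/Topology/FourManifolds/PlanarLefschetzBodyCounterexample.lean`; see the module docstring,
STATUS.)  **Modulo F-a and F-W, the Stein filling of the fact is a planar PALF body with `|A| = n`
unimodular in-range vanishing cycles on `n + 1 ≤ ob.k` binding components** — the first paragraph of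
Oba's proof of Thm. 1.1 (§3.2: *"By Theorem 1.3 and Proposition 3.6, `X` admits a PALF
`f : X → D²` with fiber `Σ_{0,4}`"*, and Lemma 3.4) in the tree's words: for a compact contractible
Stein domain `(W, J)` whose complex tangencies are supported by a planar open book `ob` (read as
`(P_n, φ)` with `n + 1 ≤ ob.k` by `Oba2016_planarMonodromy_of_supported`), `W = X(P_n; A)` for a
positive factorisation `A` of `φ` (`wendl_planarSteinFilling_of_bisection`) with `A.length = n`
(`Oba2016_length_eq_of_contractible`) and `Unimodular n A` (`Oba2016_unimodular_of_contractible`).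
[cite: Oba2016, Thm. 1.1 (proof, §3.2, first paragraph), Prop. 3.6, Lemma 3.4]
[cite: Wendl2010, Thm. 1] -/
theorem Oba2016_planarLefschetzBody_of_supported (hFa : supportedPlanarMonodromy)
    (hW : wendl_planarSteinBisection) (h1 : planarLefschetzBody_length_of_acyclic)
    (h2 : planarLefschetzBody_unimodular_of_isZero_H1)
    {W : Type} [TopologicalSpace W] [T2Space W] [SecondCountableTopology W]
    [ChartedSpace (EuclideanHalfSpace 4) W] [IsManifold (𝓡∂ 4) ∞ W] [CompactSpace W]
    [ContractibleSpace W] (S : SteinStructure W) (b : BoundaryData (𝓡∂ 4) W (𝓡 3))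
    (ob : OpenBook b.carrier) (hpl : ob.IsPlanar) (hsup : ob.Supports (boundaryPlaneField S.J b)) :
    ∃ (n : ℕ) (φ : ArcData n) (A : List PlanarCurve), n + 1 ≤ ob.k ∧ (∀ c ∈ A, c.InRange n) ∧
      monodromy n (positiveWord A) = φ ∧ A.length = n ∧ Unimodular n A ∧
      IsPlanarLefschetzBody W n (positiveWord A) := by
  obtain ⟨K, α, n, φ, hn, -, -, hG, hpos, hmono⟩ :=
    Oba2016_planarMonodromy_of_supported hFa S b ob hpl hsup
  obtain ⟨A, hAr, hAφ, hWA⟩ := wendl_planarSteinFilling_of_bisection hW S b K α n φ hG hpos hmono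
  have hlen : A.length = n := by
    have h := Oba2016_length_eq_of_contractible h1 hWA
    simpa [positiveWord] using h
  exact ⟨n, φ, A, hn, hAr, hAφ, hlen, Oba2016_unimodular_of_contractible h2 hWA, hWA⟩

/-! ### Oba's parity step: a unimodular factorisation has a curve enclosing an odd number of holes -/

section Parity

variable {n : ℕ}

/-- **A parity `F_n → ℤ/2` (every lasso `x_i ↦ 1`) is invariant under every arc-data automorphism
of `F_n`**: `φ.aut` sends `x_i` to a conjugate `u_i x_{π i} u_i⁻¹` of a lasso, and conjugations die
in the abelian group `ℤ/2`; so the parity of a class does not depend on the coordinates in which a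
curve is written (it is the functional "sum of the coordinates" on `H₁(P_n; ℤ/2)`, invariant under
the mapping class group, which permutes the holes). [folklore] -/
theorem Oba2016_parity_aut (p : FreeGroup (Fin n) →* Multiplicative (ZMod 2))
    (hp : ∀ i, p (FreeGroup.of i) = Multiplicative.ofAdd 1) (φ : ArcData n) (x : FreeGroup (Fin n)) :
    p (φ.aut x) = p x := by
  suffices h : p.comp φ.aut = p from DFunLike.congr_fun h x
  refine FreeGroup.ext_hom _ _ fun i => ?_
  simp [ArcData.aut, hp, mul_comm, mul_assoc]

/-- **The parity of a round block `x_a ⋯ x_b` is the parity of the number of holes it encloses**,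
`#{i < n | a ≤ i ≤ b}` (the exponent sum of the block word). [folklore] -/
theorem Oba2016_parity_blockWord (p : FreeGroup (Fin n) →* Multiplicative (ZMod 2))
    (hp : ∀ i, p (FreeGroup.of i) = Multiplicative.ofAdd 1) (a b : ℕ) :
    p (PGen.blockWord n a b) =
      Multiplicative.ofAdd
        ((((List.finRange n).filter fun i => decide (a ≤ i.val ∧ i.val ≤ b)).length : ℕ) : ZMod 2) := by
  classical
  set L := (List.finRange n).filter fun i => decide (a ≤ i.val ∧ i.val ≤ b) with hL
  have h1 : PGen.blockWord n a b = (L.map FreeGroup.of).prod := rfl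
  have hconst : (⇑p ∘ FreeGroup.of : Fin n → Multiplicative (ZMod 2)) =
      fun _ => Multiplicative.ofAdd 1 := by
    funext i; simp [hp]
  rw [h1, map_list_prod, List.map_map, hconst, List.map_const', List.prod_replicate, ← ofAdd_nsmul,
    nsmul_one]

/-- **The number of holes enclosed by an in-range round block**: for `b < n` the block
`{i < n | a ≤ i ≤ b}` has `b + 1 - a` elements. [folklore] -/
theorem Oba2016_length_filter_block {a b : ℕ} (hb : b < n) :
    ((List.finRange n).filter fun i => decide (a ≤ i.val ∧ i.val ≤ b)).length = b + 1 - a := by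
  classical
  have hmap : ((List.finRange n).filter fun i => decide (a ≤ i.val ∧ i.val ≤ b)).map Fin.val =
      (List.range n).filter fun i => decide (a ≤ i ∧ i ≤ b) := by
    rw [← List.map_coe_finRange_eq_range, List.filter_map]
    rfl
  rw [← List.length_map (f := Fin.val), hmap]
  have hrange : List.range n = List.Ico 0 n := (List.Ico.zero_bot n).symm
  have hsplit : ((List.range n).filter fun i => decide (a ≤ i ∧ i ≤ b)) =
      ((List.Ico 0 n).filter fun i => decide (i < b + 1)).filter fun i => decide (a ≤ i) := by
    rw [hrange, List.filter_filter]
    congr 1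
    funext i
    by_cases h₁ : a ≤ i <;> by_cases h₂ : i ≤ b <;> simp [h₁, h₂]
  rw [hsplit, List.Ico.filter_lt, List.Ico.filter_le, List.Ico.length]
  omega

/-- **The parity of the class of a syntactic curve** `c = g(c_[a,b])` with `b < n`: the class
`cls n c = g_*(x_a ⋯ x_b)` has parity `b + 1 - a (mod 2)`, the number of holes the curve encloses
(`Oba2016_parity_aut`: the carrying word `g` acts by an arc-data automorphism). [folklore] -/
theorem Oba2016_parity_cls (p : FreeGroup (Fin n) →* Multiplicative (ZMod 2))
    (hp : ∀ i, p (FreeGroup.of i) = Multiplicative.ofAdd 1) (c : PlanarCurve) (hb : c.b < n) :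
    p (c.cls n) = Multiplicative.ofAdd (((c.b + 1 - c.a : ℕ) : ZMod 2)) := by
  rw [PlanarCurve.cls, Oba2016_parity_aut p hp, Oba2016_parity_blockWord p hp,
    Oba2016_length_filter_block hb]

/-- **Oba's parity step: a unimodular factorisation has a curve enclosing an ODD number of holes.**
If `n ≥ 1`, every curve of `A` is in range, and the classes of the curves of `A` generate
`F_nᵃᵇ = H₁(P_n; ℤ) = ℤⁿ` (`Unimodular n A`, i.e. `H₁(X(P_n; A); ℤ) = 0`), then some `c ∈ A` encloses
an odd number `c.b + 1 - c.a` of holes.  For otherwise every class lies in the kernel of the parity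
`F_nᵃᵇ → ℤ/2` (`Oba2016_parity_cls`), a proper subgroup since `x₀ ↦ 1 ≠ 0` — Oba 2016, §3.2:
*"Suppose that `α, β` and `γ` are all non-boundary curves. … this contradicts Lemma 3.4"* (there via
the abelianisation of `Mod(Σ_{0,4})`; here by the equivalent count in `H₁(P_n; ℤ/2)`: curves each
enclosing an even number of holes have classes of even weight, which cannot span `(ℤ/2)ⁿ`).
[cite: Oba2016, Thm. 1.1 (proof, §3.2, "at least one of the curves is a boundary curve")] -/
theorem Oba2016_exists_odd_block_of_unimodular {A : List PlanarCurve} (hn : 0 < n)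
    (hA : ∀ c ∈ A, c.InRange n) (hU : Unimodular n A) :
    ∃ c ∈ A, Odd (c.b + 1 - c.a) := by
  classical
  by_contra hne
  push Not at hne
  -- the parity, on the free group and on its abelianisation
  let q : FreeGroup (Fin n) →* Multiplicative (ZMod 2) := FreeGroup.lift fun _ => Multiplicative.ofAdd 1
  have hq : ∀ i, q (FreeGroup.of i) = Multiplicative.ofAdd 1 := fun i => by simp [q]
  let p : Abelianization (FreeGroup (Fin n)) →* Multiplicative (ZMod 2) := Abelianization.lift q
  have hp : ∀ x, p (Abelianization.of x) = q x := fun x => by simp [p]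
  -- every generating class has parity `0`
  have hgen : ∀ y ∈ {x | x ∈ A.map fun c => Abelianization.of (PlanarCurve.cls n c)}, p y = 1 := by
    rintro y hy
    simp only [Set.mem_setOf_eq, List.mem_map] at hy
    obtain ⟨c, hc, rfl⟩ := hy
    rw [hp, Oba2016_parity_cls q hq c (hA c hc).2.1]
    have hev : Even (c.b + 1 - c.a) := Nat.not_odd_iff_even.1 (hne c hc)
    obtain ⟨k, hk⟩ := hev
    rw [hk, show ((k + k : ℕ) : ZMod 2) = 0 by
      rw [Nat.cast_add, ← two_mul]
      exact mul_eq_zero_of_left (by decide) _]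
    rfl
  -- hence the whole closure, i.e. everything, has parity `0`
  have hall : ∀ y : Abelianization (FreeGroup (Fin n)), p y = 1 := by
    intro y
    have hy : y ∈ Subgroup.closure {x | x ∈ A.map fun c => Abelianization.of (PlanarCurve.cls n c)} := by
      rw [show Subgroup.closure _ = ⊤ from hU]
      exact Subgroup.mem_top y
    refine Subgroup.closure_induction (fun x hx => hgen x hx) (map_one p) ?_ ?_ hy
    · intro x y _ _ hx hy
      rw [map_mul, hx, hy, mul_one]
    · intro x _ hx
      rw [map_inv, hx, inv_one]
  -- but the lasso `x₀` has parity `1`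
  have h0 := hall (Abelianization.of (FreeGroup.of (⟨0, hn⟩ : Fin n)))
  rw [hp, hq] at h0
  exact absurd (congrArg Multiplicative.toAdd h0) (by decide)

/-- **For the page `Σ_{0,4} = P_3`: a unimodular factorisation contains a BOUNDARY curve.**  With
`n = 3` holes an in-range curve `g(c_[a,b])`, `a ≤ b < 3`, enclosing an odd number of holes encloses
one hole (`a = b`: parallel to that inner boundary circle) or all three (`a = 0`, `b = 2`: parallel
to the outer boundary circle); so if the classes of `A` generate `H₁(P_3; ℤ)` then some curve of `A`
is a boundary curve — Oba 2016, §3.2: *"Therefore at least one of the curves `α, β` and `γ` is a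
boundary curve"*, the case distinction (1)–(3) of the proof of Thm. 1.1.
[cite: Oba2016, Thm. 1.1 (proof, §3.2)] -/
theorem Oba2016_exists_boundaryParallel_of_unimodular_three {A : List PlanarCurve}
    (hA : ∀ c ∈ A, c.InRange 3) (hU : Unimodular 3 A) :
    ∃ c ∈ A, c.a = c.b ∨ (c.a = 0 ∧ c.b = 2) := by
  obtain ⟨c, hc, hodd⟩ := Oba2016_exists_odd_block_of_unimodular (by norm_num) hA hU
  refine ⟨c, hc, ?_⟩
  obtain ⟨hab, hb, -⟩ := hA c hc
  obtain ⟨k, hk⟩ := hodd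
  omega

end Parity

/-! ### The fact from the named dictionary facts and the geometric endgame in word currency -/

/-- (VACUOUS as filed: the hypotheses `h1`, `h2` are refuted in
`Literature/Topology/FourManifolds/PlanarLefschetzBodyCounterexample.lean`; see the module docstring,
STATUS.)  **Oba 2016, Thm. 1.1 from the named dictionary facts F-a, F-W, the readers `|A| = n` and
unimodularity, and the residual geometric endgame.**  Suppose `supportedPlanarMonodromy` (F-a),
`wendl_planarSteinBisection` (F-W), `planarLefschetzBody_length_of_acyclic` and
`planarLefschetzBody_unimodular_of_isZero_H1` (the readers of `PlanarLefschetzBodyFacts.lean`), and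
(`hX`) the GEOMETRIC ENDGAME of the printed proof in the currency of the planar word calculus: every
compact planar Lefschetz body `X(P_n; A)` with `n ≤ 3`, `|A| = n` in-range positive letters and
unimodular hole-set matrix carries a Morse function adapted to the boundary with at most one
critical point of index `1` and all indices `≤ 2` — on paper: Kas' decomposition
`h⁰ ∪ n h¹ ∪ n h²` of the PALF (Gompf–Stipsicz §8.2), a boundary curve among the vanishing cycles
(`Oba2016_exists_boundaryParallel_of_unimodular_three`), standard position of a second curve by a
total conjugation, and the cancellation of the two evident `1`/`2`-handle pairs of Fig. 2 (Oba 2016,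
§3.2, cases (1)–(3); for `n ≤ 2` every in-range curve is a boundary curve).  Then
`Oba2016_steinFilling_fourHoledSphere` holds: by `Oba2016_steinFilling_fourHoledSphere_of_supported_of_endgame`
it suffices to produce such a Morse function on every compact contractible Stein domain whose
boundary book is in Giroux form, positively framed, with planar monodromy on `n ≤ 3` holes; F-W makes
it `X(P_n; A)` (`wendl_planarSteinFilling_of_bisection`), contractibility gives `|A| = n` and
unimodularity (`Oba2016_length_eq_of_contractible`, `Oba2016_unimodular_of_contractible`), and `hX`
applies. [cite: Oba2016, Thm. 1.1 (proof, §3.2)] [cite: Wendl2010, Thm. 1]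
[cite: GompfStipsiczGSM1999, §8.2] -/
theorem Oba2016_steinFilling_fourHoledSphere_of_dictionary (hFa : supportedPlanarMonodromy)
    (hW : wendl_planarSteinBisection) (h1 : planarLefschetzBody_length_of_acyclic)
    (h2 : planarLefschetzBody_unimodular_of_isZero_H1)
    (hX : ∀ (X : Type) [TopologicalSpace X] [T2Space X] [SecondCountableTopology X]
      [ChartedSpace (EuclideanHalfSpace 4) X] [IsManifold (𝓡∂ 4) ∞ X] [CompactSpace X]
      (n : ℕ) (A : List PlanarCurve), n ≤ 3 → (∀ c ∈ A, c.InRange n) → A.length = n →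
      Unimodular n A → IsPlanarLefschetzBody X n (positiveWord A) →
      ∃ f : X → ℝ, IsMorseAdapted (𝓡∂ 4) f ∧ (criticalSetOfIndex (𝓡∂ 4) f 1).ncard ≤ 1 ∧
        ∀ z, IsMCriticalPt (𝓡∂ 4) f z → morseIndex (𝓡∂ 4) f z ≤ 2) :
    Oba2016_steinFilling_fourHoledSphere := by
  refine Oba2016_steinFilling_fourHoledSphere_of_supported_of_endgame hFa
    fun W _ _ _ _ _ _ _ S b K α n φ hn hG hpos hmono => ?_
  obtain ⟨A, hAr, hAφ, hWA⟩ := wendl_planarSteinFilling_of_bisection hW S b K α n φ hG hpos hmono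
  have hlen : A.length = n := by
    have h := Oba2016_length_eq_of_contractible h1 hWA
    simpa [positiveWord] using h
  exact hX W n A hn hAr hlen (Oba2016_unimodular_of_contractible h2 hWA) hWA

end Literature.Geometry.Symplectic

end
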